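import Summits.NavierStokesRegularity.NavierStokesRegularity.Theorems.AxisTwistDoorAveragedConeLiouvilleNUDensityAtom
import Summits.NavierStokesRegularity.NavierStokesRegularity.Theorems.AxisTwistDoorAveragedConeLiouvilleNULipDefs
import HarnessLib

/-!
# N4 / T1 piece L32ᴸ: `NU.nuLip_densityPropagation : Sig.nuLip_densityPropagation` — Nazarov–Ural'tseva
# 2011, Lemma 3.2 (propagation of density forward in time) over LIPSCHITZ slices

Route `AxisTwistDoor`, crux `AveragedConeLiouville` (stmt-NavierStokesRegularity-26889), INPUT N4 / T1 (the
typed Literature fact `NazarovUraltseva2011_positivity_propagation (EuclideanSpace ℝ (Fin 3))` for Lipschitz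
generalized supersolutions), texts of record `pub/ns-inputs/kits/N4-T1-skeleton.lean` (sha16
118454bf17607d1e), stub `stub_nuLip_densityPropagation`; seat ns-in-ser-a g3, cut of record pub/ns-inputs STATUS
2026-08-28T13:52:58Z.

OBSERVATION THAT MAKES THIS PIECE SHORT. The landed classical atom `nu_densityPropagation` (ser-b g2, p634497,
`…NUDensityAtom`) and its slice estimate `nu_measure_sublevel_slice_le_rpow` (p633231, `…NUDensitySlice`) never
use the slice-`C¹` clause of `NUStanding`: the proof destructures the standing hypotheses as
`⟨-, hR, hΦm, hUvol, -, hΦ0, -, hdrift, hEC⟩` (continuity and the slice clause are discarded) and the slice lemma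
takes only measurability, nonnegativity, the drift and the ENERGY CLASS. So the density atom holds in the
slice-clause-free form `nu_densityPropagation_of_energyClass` below (explicit hypotheses `0 < R`,
`Measurable (uncurry Φ)`, `AEStronglyMeasurable (uncurry U)`, `Φ ≥ 0`, the drift class, `NUEnergyClass Φ U k R`;
proof = the landed proof VERBATIM with the destructuring line replaced by `intro`s), and BOTH the classical text
`Sig.nu_densityPropagation` (over `NUStanding`) and the Lipschitz text `Sig.nuLip_densityPropagation` (over
`NUStandingLip`, `…NULipDefs`) are 6-line instances.

* `nu_densityPropagation_of_energyClass` — the core (N–U Lemma 3.2 in the axis-free energy class, no slice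
  regularity clause at all);
* `NU.nuLip_densityPropagation : Sig.nuLip_densityPropagation` — L32ᴸ VERBATIM (landing check
  `example : Sig.nuLip_densityPropagation := NU.nuLip_densityPropagation`).

WHAT THIS IS NOT: not a statement about Navier–Stokes; T1 is an INPUT (a printed theorem re-proved); item 26889
(conditional on N3 only) and the summit stay open.
[cite: NazarovUraltseva2011HarnackDivFree, Lemma 3.2 (arXiv:1011.1888 p. 9)] [cite: LeiRenTian2025, Lemma 2.5]
-/

-- the problem directory repeats the summit name (D-0017); core's `dupNamespace` linter fires
set_option linter.dupNamespace false

noncomputable section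

open MeasureTheory Set Function Filter Topology Metric Module
open scoped NNReal ENNReal

namespace Summit.NavierStokesRegularity.NavierStokesRegularity.Theorems.AveragedConeLiouville.NUPositivity

open Summit.NavierStokesRegularity.NavierStokesRegularity.Theorems.AxisymmetricKatoGlobal.EulerScaling

open Literature.Analysis.FluidPDE Literature.Analysis.FluidPDE.LeiZhang2011


set_option maxHeartbeats 400000 in
/-- **The density atom of Nazarov–Ural'tseva 2011 (Lemma 3.2, propagation of density forward in time) in the
axis-free ENERGY CLASS, with no slice-regularity clause.** For every `0 < δ₀ ≤ 1` and drift constant `N` there is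
`θ₀ ∈ ]0,1[` such that: whenever `0 < R`, `Φ ≥ 0` is jointly measurable, `U` is a.e.-strongly measurable, the
drift class `∫_{-R²}^0 (∫_{B(2R)} |U|³)^{4/3} ≤ N R²` and the energy class `NUEnergyClass Φ U k R` hold, then for
`R/4 ≤ ρ ≤ 2R`, `0 < θ ≤ θ₀`, `t₀ ≤ 0`, `-R² < t₀ - θρ²`, `0 < κ ≤ k`, the density
`|B(ρ) ∩ {κ ≤ Φ(t₀-θρ²,·)}| ≥ δ₀|B(ρ)|` propagates to `|B(ρ) ∩ {δ₀κ/3 ≤ Φ(t,·)}| ≥ (δ₀/3)|B(ρ)|` for all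
`t ∈ [t₀-θρ², t₀]`, `t < 0`. (The landed `nu_densityPropagation`, p634497, is the instance over `NUStanding`;
its proof is reproduced here verbatim with the destructuring of the standing hypotheses replaced by the
explicit binders — the slice-`C¹` clause and the continuity clause were never used.)
[cite: NazarovUraltseva2011HarnackDivFree, Lemma 3.2 (arXiv:1011.1888 p. 9)] -/
theorem nu_densityPropagation_of_energyClass :
    ∀ (δ₀ : ℝ) (N : ℝ≥0), 0 < δ₀ → δ₀ ≤ 1 →
    ∃ θ₀ : ℝ, 0 < θ₀ ∧ θ₀ < 1 ∧
    ∀ (Φ : ℝ → EuclideanSpace ℝ (Fin 3) → ℝ) (U : ℝ → EuclideanSpace ℝ (Fin 3) → EuclideanSpace ℝ (Fin 3)) (k R : ℝ),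
      0 < R → Measurable (uncurry Φ) → AEStronglyMeasurable (uncurry U) volume → (∀ t x, 0 ≤ Φ t x) →
      (∫⁻ s in Ioo (-R ^ 2) 0, (∫⁻ y in ball (0 : EuclideanSpace ℝ (Fin 3)) (2 * R),
          ‖U s y‖ₑ ^ (3 : ℕ)) ^ (4 / 3 : ℝ) ≤ (N : ℝ≥0∞) * ENNReal.ofReal R ^ 2) →
      NUEnergyClass Φ U k R →
    ∀ (ρ θ t₀ κ : ℝ), R / 4 ≤ ρ → ρ ≤ 2 * R → 0 < θ → θ ≤ θ₀ →
      t₀ ≤ 0 → -R ^ 2 < t₀ - θ * ρ ^ 2 → 0 < κ → κ ≤ k →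
      ENNReal.ofReal δ₀ * volume (ball (0 : EuclideanSpace ℝ (Fin 3)) ρ)
        ≤ volume {x : EuclideanSpace ℝ (Fin 3) | x ∈ ball (0 : EuclideanSpace ℝ (Fin 3)) ρ ∧ κ ≤ Φ (t₀ - θ * ρ ^ 2) x} →
      ∀ t ∈ Icc (t₀ - θ * ρ ^ 2) t₀, t < 0 →
        ENNReal.ofReal (δ₀ / 3) * volume (ball (0 : EuclideanSpace ℝ (Fin 3)) ρ)
          ≤ volume {x : EuclideanSpace ℝ (Fin 3) | x ∈ ball (0 : EuclideanSpace ℝ (Fin 3)) ρ ∧ δ₀ * κ / 3 ≤ Φ t x} := by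
  intro δ₀ N hδ₀ hδ₀1
  obtain ⟨γ, hγdef⟩ : ∃ γ : ℝ, γ = δ₀ / 3 := ⟨_, rfl⟩
  have hγ : 0 < γ := by rw [hγdef]; positivity
  have hγ1 : γ < 1 := by rw [hγdef]; linarith
  set Δ : ℝ := (1 - γ) ^ 2 * (1 - δ₀ / 3) - (1 - δ₀) with hΔ
  have hΔ0 : 0 < Δ := by
    rw [hΔ, hγdef]; nlinarith [mul_pos hδ₀ hδ₀, hδ₀1]
  -- ### absolute constants
  obtain ⟨Cg, hCg0, hCg⟩ := exists_norm_fderiv_radialCutoff_le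
  obtain ⟨C₁, hC₁⟩ := lintegral_inv_cylRadius_rpow_ball_le 1 (by norm_num) (by norm_num)
  set V₁ : ℝ := (volume (ball (0 : EuclideanSpace ℝ (Fin 3)) 1)).toReal with hV₁
  have hB1fin : volume (ball (0 : EuclideanSpace ℝ (Fin 3)) 1) < ∞ := measure_ball_lt_top
  have hV₁pos : 0 < V₁ := ENNReal.toReal_pos (measure_ball_pos _ _ one_pos).ne' hB1fin.ne
  set N' : ℝ := (N : ℝ) with hN'
  have hN'0 : 0 ≤ N' := N.coe_nonneg
  -- ### the parameters `σ`, `E₁`, `θ₀`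
  set σ : ℝ := min (1 / 2) (Δ / 6) with hσ
  have hσpos : 0 < σ := by rw [hσ]; exact lt_min (by norm_num) (by positivity)
  have hσle : σ ≤ 1 / 2 := min_le_left _ _
  have h3σ : 3 * σ ≤ Δ / 2 := by have := min_le_right (1 / 2 : ℝ) (Δ / 6); rw [← hσ] at this; linarith
  set E₁ : ℝ := 16 * Cg ^ 2 / σ ^ 2 +
    4 * Cg * ((16 * N') ^ (1 / 4 : ℝ) * (16 : ℝ) ^ (1 / 12 : ℝ) * V₁ ^ (2 / 3 : ℝ)) / (σ * V₁) +
    32 * Cg * (C₁ : ℝ) / (σ * V₁) with hE₁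
  have hE₁0 : 0 ≤ E₁ := by positivity
  set θ₀ : ℝ := min (1 / 2) ((Δ / (2 * (E₁ + 1))) ^ 2) with hθ₀
  have hθ₀pos : 0 < θ₀ := by rw [hθ₀]; exact lt_min (by norm_num) (by positivity)
  have hθ₀lt : θ₀ < 1 := (min_le_left _ _).trans_lt (by norm_num)
  have hθ₀le : θ₀ ≤ (Δ / (2 * (E₁ + 1))) ^ 2 := min_le_right _ _
  clear_value σ E₁ θ₀ N' V₁ Δ
  refine ⟨θ₀, hθ₀pos, hθ₀lt, ?_⟩
  intro Φ U k R hR hΦm hUvol hΦ0 hdrift hEC ρ θ t₀ κ hρR hρ2R hθ hθθ₀ ht₀ hbot hκ hκk hdens t ht htneg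
  have hU : AEStronglyMeasurable (uncurry U)
      (volume.restrict (Ioo (-R ^ 2) 0 ×ˢ ball (0 : EuclideanSpace ℝ (Fin 3)) (2 * R))) :=
    hUvol.restrict
  have hγκ3 : δ₀ * κ / 3 = γ * κ := by rw [hγdef]; ring
  simp_rw [hγκ3]
  have hρ : 0 < ρ := by linarith
  have hθ1 : θ ≤ 1 := (hθθ₀.trans hθ₀lt.le)
  set a : ℝ := t₀ - θ * ρ ^ 2 with ha
  -- measurability of the slices and the basic volumes
  have hslm : ∀ s : ℝ, Measurable (Φ s) := fun s => hΦm.comp (measurable_const.prodMk measurable_id)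
  have hBvol : volume (ball (0 : EuclideanSpace ℝ (Fin 3)) ρ) =
      ENNReal.ofReal (ρ ^ 3) * volume (ball (0 : EuclideanSpace ℝ (Fin 3)) 1) := by
    rw [Measure.addHaar_ball_of_pos volume _ hρ, finrank_euclideanSpace_fin]
  have hBfin : volume (ball (0 : EuclideanSpace ℝ (Fin 3)) ρ) < ∞ := measure_ball_lt_top
  have hBreal : (volume (ball (0 : EuclideanSpace ℝ (Fin 3)) ρ)).toReal = V₁ * ρ ^ 3 := by
    rw [hBvol, ENNReal.toReal_mul, ENNReal.toReal_ofReal (by positivity), hV₁]; ring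
  -- the superlevel set at time `t` through the sublevel set
  have hsplit : ∀ (s c : ℝ),
      volume {x : EuclideanSpace ℝ (Fin 3) | x ∈ ball (0 : EuclideanSpace ℝ (Fin 3)) ρ ∧ c ≤ Φ s x} =
        volume (ball (0 : EuclideanSpace ℝ (Fin 3)) ρ) -
          volume (ball (0 : EuclideanSpace ℝ (Fin 3)) ρ ∩ {x | Φ s x < c}) := by
    intro s c
    have hm : MeasurableSet {x : EuclideanSpace ℝ (Fin 3) | Φ s x < c} :=
      measurableSet_lt (hslm s) measurable_const
    have h := measure_inter_add_sdiff (μ := volume) (ball (0 : EuclideanSpace ℝ (Fin 3)) ρ) hm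
    have e : ball (0 : EuclideanSpace ℝ (Fin 3)) ρ \ {x | Φ s x < c} =
        {x | x ∈ ball (0 : EuclideanSpace ℝ (Fin 3)) ρ ∧ c ≤ Φ s x} := by
      ext x; simp [not_lt]
    rw [← e, ← h, ENNReal.add_sub_cancel_left
      ((measure_mono inter_subset_left).trans_lt hBfin).ne]
  -- ### the degenerate case `t = a`
  rcases eq_or_lt_of_le ht.1 with hta | hta
  · -- the initial density itself, `{κ ≤ Φ} ⊆ {γκ ≤ Φ}`
    have hγκ : γ * κ ≤ κ := mul_le_of_le_one_left hκ.le hγ1.le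
    calc ENNReal.ofReal (δ₀ / 3) * volume (ball (0 : EuclideanSpace ℝ (Fin 3)) ρ)
        ≤ ENNReal.ofReal δ₀ * volume (ball (0 : EuclideanSpace ℝ (Fin 3)) ρ) :=
          mul_le_mul' (ENNReal.ofReal_le_ofReal (by linarith)) le_rfl
      _ ≤ _ := hdens
      _ ≤ _ := by
          rw [← hta]
          exact measure_mono fun x hx => ⟨hx.1, hγκ.trans hx.2⟩
  -- ### the case `a < t`: geometry
  set r : ℝ := (1 - σ) * ρ with hr
  set r₁ : ℝ := (1 - σ / 2) * ρ with hr₁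
  have hrpos : 0 < r := by rw [hr]; exact mul_pos (by linarith) hρ
  have hrr₁ : r < r₁ := by rw [hr, hr₁]; exact mul_lt_mul_of_pos_right (by linarith) hρ
  have hr₁ρ : r₁ < ρ := by
    rw [hr₁]
    calc (1 - σ / 2) * ρ < 1 * ρ := mul_lt_mul_of_pos_right (by linarith) hρ
      _ = ρ := one_mul ρ
  have hr₁pos : 0 < r₁ := hrpos.trans hrr₁
  have hr₁R : r₁ < 2 * R := hr₁ρ.trans_le hρ2R
  have hdiffr : r₁ - r = σ / 2 * ρ := by rw [hr, hr₁]; ring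
  have hR4 : R ≤ 4 * ρ := by linarith
  have hta' : t - a ≤ θ * ρ ^ 2 := by rw [ha]; linarith [ht.2]
  have hta0 : 0 < t - a := by linarith
  -- the sub-cylinder `W = [a, t] × B̄(r₁)` of the slab
  set W : Set (ℝ × EuclideanSpace ℝ (Fin 3)) :=
    Icc a t ×ˢ closedBall (0 : EuclideanSpace ℝ (Fin 3)) r₁ with hW
  have hWsub : W ⊆ Ioo (-R ^ 2) 0 ×ˢ ball (0 : EuclideanSpace ℝ (Fin 3)) (2 * R) :=
    prod_mono (fun s hs => ⟨hbot.trans_le hs.1, hs.2.trans_lt htneg⟩) (closedBall_subset_ball hr₁R)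
  have hWvol : volume W = ENNReal.ofReal (t - a) * (ENNReal.ofReal (r₁ ^ 3) *
      volume (ball (0 : EuclideanSpace ℝ (Fin 3)) 1)) := by
    rw [hW, Measure.volume_eq_prod, Measure.prod_prod, Real.volume_Icc,
      Measure.addHaar_closedBall volume _ hr₁pos.le, finrank_euclideanSpace_fin]
  set θ' : ℝ := (t - a) / ρ ^ 2 with hθ'
  have hθ'pos : 0 < θ' := div_pos hta0 (by positivity)
  have hθ'le : θ' ≤ θ := by rw [hθ', div_le_iff₀ (by positivity)]; exact hta'
  have hWreal : (volume W).toReal = θ' * V₁ * (1 - σ / 2) ^ 3 * ρ ^ 5 := by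
    rw [hWvol, ENNReal.toReal_mul, ENNReal.toReal_mul, ENNReal.toReal_ofReal hta0.le,
      ENNReal.toReal_ofReal (by positivity), hV₁, hr₁, hθ']
    field_simp
  have hVK : (volume (closedBall (0 : EuclideanSpace ℝ (Fin 3)) r₁)).toReal = V₁ * r₁ ^ 3 := by
    rw [Measure.addHaar_closedBall volume _ hr₁pos.le, finrank_euclideanSpace_fin, ENNReal.toReal_mul,
      ENNReal.toReal_ofReal (by positivity), hV₁]; ring
  -- ### the drift and axis integrals
  set IU : ℝ≥0∞ := ((N : ℝ≥0∞) * ENNReal.ofReal R ^ 2) ^ (1 / 4 : ℝ) *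
    ENNReal.ofReal (R ^ 2) ^ (1 / 12 : ℝ) * volume W ^ (2 / 3 : ℝ) with hIU
  have hIUle : ∫⁻ z in W, ‖U z.1 z.2‖ₑ ≤ IU := lintegral_enorm_drift_le hU hdrift hWsub
  have hWfin : volume W < ∞ := by
    rw [hWvol]
    exact ENNReal.mul_lt_top ENNReal.ofReal_lt_top (ENNReal.mul_lt_top ENNReal.ofReal_lt_top hB1fin)
  have hIUfin : IU ≠ ∞ := by
    refine ENNReal.mul_ne_top (ENNReal.mul_ne_top ?_ ?_) ?_
    · exact (ENNReal.rpow_lt_top_of_nonneg (by norm_num)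
        (ENNReal.mul_ne_top ENNReal.coe_ne_top (ENNReal.pow_ne_top ENNReal.ofReal_ne_top))).ne
    · exact (ENNReal.rpow_lt_top_of_nonneg (by norm_num) ENNReal.ofReal_ne_top).ne
    · exact (ENNReal.rpow_lt_top_of_nonneg (by norm_num) hWfin.ne).ne
  have hIUreal : IU.toReal = (N' * R ^ 2) ^ (1 / 4 : ℝ) * (R ^ 2) ^ (1 / 12 : ℝ) *
      (θ' * V₁ * (1 - σ / 2) ^ 3 * ρ ^ 5) ^ (2 / 3 : ℝ) := by
    rw [hIU, ENNReal.toReal_mul, ENNReal.toReal_mul, ← ENNReal.toReal_rpow, ← ENNReal.toReal_rpow,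
      ← ENNReal.toReal_rpow, ENNReal.toReal_mul, ENNReal.toReal_pow, ENNReal.toReal_ofReal hR.le,
      ENNReal.toReal_ofReal (by positivity), hWreal, ENNReal.coe_toReal, ← hN']
  have hIUbound : IU.toReal ≤ (16 * N') ^ (1 / 4 : ℝ) * (16 : ℝ) ^ (1 / 12 : ℝ) *
      V₁ ^ (2 / 3 : ℝ) * θ ^ (1 / 2 : ℝ) * ρ ^ 4 := by
    rw [hIUreal]
    have h1 := drift_real_bound (θmax := θ) (lam' := 1 - σ / 2) hN'0 hR hρ hR4 hθ'pos hθ'le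
      hV₁pos.le (by linarith)
    refine h1.trans ?_
    have h2 : (θ * V₁ * (1 - σ / 2) ^ 3) ^ (2 / 3 : ℝ) ≤ V₁ ^ (2 / 3 : ℝ) * θ ^ (1 / 2 : ℝ) := by
      have hl1 : (1 - σ / 2) ^ 3 ≤ 1 := by
        have h0 : 0 ≤ 1 - σ / 2 := by linarith
        calc (1 - σ / 2) ^ 3 ≤ 1 ^ 3 := pow_le_pow_left₀ h0 (by linarith) 3
          _ = 1 := one_pow 3
      calc (θ * V₁ * (1 - σ / 2) ^ 3) ^ (2 / 3 : ℝ) ≤ (θ * V₁) ^ (2 / 3 : ℝ) := by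
            refine Real.rpow_le_rpow (mul_nonneg (by positivity) (pow_nonneg (by linarith) 3)) ?_
              (by norm_num)
            have : 0 ≤ θ * V₁ := by positivity
            exact mul_le_of_le_one_right this hl1
        _ = θ ^ (2 / 3 : ℝ) * V₁ ^ (2 / 3 : ℝ) := Real.mul_rpow hθ.le hV₁pos.le
        _ ≤ θ ^ (1 / 2 : ℝ) * V₁ ^ (2 / 3 : ℝ) := by
            refine mul_le_mul_of_nonneg_right ?_ (by positivity)
            exact Real.rpow_le_rpow_of_exponent_ge hθ hθ1 (by norm_num)
        _ = V₁ ^ (2 / 3 : ℝ) * θ ^ (1 / 2 : ℝ) := mul_comm _ _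
    calc (16 * N') ^ (1 / 4 : ℝ) * (16 : ℝ) ^ (1 / 12 : ℝ) * (θ * V₁ * (1 - σ / 2) ^ 3) ^ (2 / 3 : ℝ) *
          ρ ^ 4 ≤ (16 * N') ^ (1 / 4 : ℝ) * (16 : ℝ) ^ (1 / 12 : ℝ) * (V₁ ^ (2 / 3 : ℝ) * θ ^ (1 / 2 : ℝ)) *
          ρ ^ 4 := by gcongr
      _ = _ := by ring
  -- ### the slice estimates for the profiles `((κ - τ)₊)^p`, `2 < p < 3`
  have hslice : ∀ p : ℝ, 2 < p →
      ((1 - γ) * κ) ^ p *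
          (volume (ball (0 : EuclideanSpace ℝ (Fin 3)) r ∩ {x | Φ t x < γ * κ})).toReal ≤
        κ ^ p * (volume (ball (0 : EuclideanSpace ℝ (Fin 3)) r₁ ∩ {x | Φ a x < κ})).toReal +
          κ ^ p * (4 * (Cg / (r₁ - r)) ^ 2 * ((t - a) *
              (volume (closedBall (0 : EuclideanSpace ℝ (Fin 3)) r₁)).toReal) +
            2 * (Cg / (r₁ - r)) * IU.toReal) := fun p hp =>
    nu_measure_sublevel_slice_le_rpow Φ U k R hΦm hΦ0 hU hEC hrpos hrr₁ hr₁R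
      hbot ht.1 htneg hκ hκk hγ hγ1 hp hCg0 (hCg r r₁ hrpos.le hrr₁) hIUfin hIUle
  -- ### real bookkeeping
  set V : ℝ := V₁ * ρ ^ 3 with hVdef
  have hV0 : 0 ≤ V := by positivity
  set m₁ : ℝ := (volume (ball (0 : EuclideanSpace ℝ (Fin 3)) r ∩ {x | Φ t x < γ * κ})).toReal
  set m₀ : ℝ := (volume (ball (0 : EuclideanSpace ℝ (Fin 3)) ρ ∩ {x | Φ a x < κ})).toReal with hm₀
  set m : ℝ := (volume (ball (0 : EuclideanSpace ℝ (Fin 3)) ρ ∩ {x | Φ t x < γ * κ})).toReal with hm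
  -- error terms `≤ E₁ √θ · V`
  have hsqrt : θ ≤ θ ^ (1 / 2 : ℝ) := by
    have := Real.rpow_le_rpow_of_exponent_ge hθ hθ1 (by norm_num : (1 / 2 : ℝ) ≤ 1)
    rwa [Real.rpow_one] at this
  have hθhalf : θ ^ (1 / 2 : ℝ) ≤ Δ / (2 * (E₁ + 1)) := by
    have h1 : θ ^ (1 / 2 : ℝ) ≤ θ₀ ^ (1 / 2 : ℝ) := Real.rpow_le_rpow hθ.le hθθ₀ (by norm_num)
    have h2 : θ₀ ^ (1 / 2 : ℝ) ≤ ((Δ / (2 * (E₁ + 1))) ^ 2) ^ (1 / 2 : ℝ) :=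
      Real.rpow_le_rpow hθ₀pos.le hθ₀le (by norm_num)
    have h3 : ((Δ / (2 * (E₁ + 1))) ^ 2) ^ (1 / 2 : ℝ) = Δ / (2 * (E₁ + 1)) := by
      rw [← Real.sqrt_eq_rpow, Real.sqrt_sq (by positivity)]
    linarith [h3 ▸ h2]
  have herr : 4 * (Cg / (r₁ - r)) ^ 2 * ((t - a) *
        (volume (closedBall (0 : EuclideanSpace ℝ (Fin 3)) r₁)).toReal) +
      2 * (Cg / (r₁ - r)) * IU.toReal + 4 * (Cg / (r₁ - r)) * ((t - a) * ((C₁ : ℝ) * (4 * r₁ ^ 2))) ≤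
      (E₁ * θ ^ (1 / 2 : ℝ)) * V := by
    rw [hVK, hdiffr, hE₁, hVdef]
    exact densityErr_real hCg0 C₁.coe_nonneg hV₁pos hσpos hθ hsqrt hρ hta' hr₁pos.le
      hr₁ρ.le hIUbound
  have he : E₁ * θ ^ (1 / 2 : ℝ) ≤ Δ / 2 := by
    calc E₁ * θ ^ (1 / 2 : ℝ) ≤ E₁ * (Δ / (2 * (E₁ + 1))) := mul_le_mul_of_nonneg_left hθhalf hE₁0
      _ = Δ / 2 * (E₁ / (E₁ + 1)) := by field_simp
      _ ≤ Δ / 2 * 1 := by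
          refine mul_le_mul_of_nonneg_left ?_ (by positivity)
          rw [div_le_one (by positivity)]; linarith
      _ = Δ / 2 := mul_one _
  -- the main real inequality for every `p ∈ ]2, 3[`, and its limit `p → 2⁺`
  have hm₀' : (volume (ball (0 : EuclideanSpace ℝ (Fin 3)) r₁ ∩ {x | Φ a x < κ})).toReal ≤ m₀ :=
    ENNReal.toReal_mono ((measure_mono inter_subset_left).trans_lt hBfin).ne
      (measure_mono (inter_subset_inter_left _ (ball_subset_ball hr₁ρ.le)))
  have hmainp : ∀ p : ℝ, 2 < p → (1 - γ) ^ p * m₁ ≤ m₀ + (E₁ * θ ^ (1 / 2 : ℝ)) * V := by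
    intro p hp
    have hκp : 0 < κ ^ p := Real.rpow_pos_of_pos hκ p
    have h1 : ((1 - γ) * κ) ^ p * m₁ ≤ κ ^ p * m₀ + κ ^ p * ((E₁ * θ ^ (1 / 2 : ℝ)) * V) :=
      (hslice p hp).trans (add_le_add (mul_le_mul_of_nonneg_left hm₀' hκp.le)
        (mul_le_mul_of_nonneg_left ((le_add_of_nonneg_right (by positivity)).trans herr) hκp.le))
    rw [Real.mul_rpow (by linarith) hκ.le] at h1
    have h2 : κ ^ p * ((1 - γ) ^ p * m₁) ≤ κ ^ p * (m₀ + (E₁ * θ ^ (1 / 2 : ℝ)) * V) := by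
      calc κ ^ p * ((1 - γ) ^ p * m₁) = (1 - γ) ^ p * κ ^ p * m₁ := by ring
        _ ≤ _ := h1
        _ = κ ^ p * (m₀ + (E₁ * θ ^ (1 / 2 : ℝ)) * V) := by ring
    exact le_of_mul_le_mul_left h2 hκp
  have hmain : (1 - γ) ^ 2 * m₁ ≤ m₀ + (E₁ * θ ^ (1 / 2 : ℝ)) * V := by
    have hcont : ContinuousAt (fun p : ℝ => (1 - γ) ^ p * m₁) 2 :=
      (Real.continuousAt_const_rpow (by linarith : (1 - γ) ≠ 0)).mul continuousAt_const
    have hlim : Tendsto (fun p : ℝ => (1 - γ) ^ p * m₁) (𝓝[>] 2) (𝓝 ((1 - γ) ^ (2 : ℝ) * m₁)) :=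
      hcont.tendsto.mono_left nhdsWithin_le_nhds
    have hev : ∀ᶠ p in 𝓝[>] (2 : ℝ), (1 - γ) ^ p * m₁ ≤ m₀ + (E₁ * θ ^ (1 / 2 : ℝ)) * V :=
      eventually_nhdsWithin_of_forall fun p hp => hmainp p hp
    have h := le_of_tendsto hlim hev
    rwa [show ((1 - γ) ^ (2 : ℝ) : ℝ) = (1 - γ) ^ 2 by
      rw [show (2 : ℝ) = ((2 : ℕ) : ℝ) by norm_num, Real.rpow_natCast]] at h
  -- the initial density: `m₀ ≤ (1 - δ₀) V`
  have hm₀le : m₀ ≤ (1 - δ₀) * V := by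
    have h := hsplit a κ
    have hsub : volume (ball (0 : EuclideanSpace ℝ (Fin 3)) ρ ∩ {x | Φ a x < κ}) ≤
        volume (ball (0 : EuclideanSpace ℝ (Fin 3)) ρ) := measure_mono inter_subset_left
    have hsup_fin : volume {x : EuclideanSpace ℝ (Fin 3) | x ∈ ball (0 : EuclideanSpace ℝ (Fin 3)) ρ ∧
        κ ≤ Φ a x} ≠ ∞ := by
      rw [h]; exact (tsub_le_self.trans_lt hBfin).ne
    have h1 := ENNReal.toReal_mono hsup_fin hdens
    rw [ENNReal.toReal_mul, ENNReal.toReal_ofReal hδ₀.le, hBreal, h,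
      ENNReal.toReal_sub_of_le hsub hBfin.ne, hBreal] at h1
    rw [hm₀, hVdef]; linarith
  -- the annulus: `m ≤ m₁ + |B(ρ) ∖ B(r)|`, `|B(ρ) ∖ B(r)| ≤ 3σ V`
  set ann : ℝ := (volume (ball (0 : EuclideanSpace ℝ (Fin 3)) ρ \
    ball (0 : EuclideanSpace ℝ (Fin 3)) r)).toReal with hann
  have hmle : m ≤ m₁ + ann := by
    have hsub : ball (0 : EuclideanSpace ℝ (Fin 3)) ρ ∩ {x | Φ t x < γ * κ} ⊆
        (ball (0 : EuclideanSpace ℝ (Fin 3)) r ∩ {x | Φ t x < γ * κ}) ∪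
          (ball (0 : EuclideanSpace ℝ (Fin 3)) ρ \ ball (0 : EuclideanSpace ℝ (Fin 3)) r) := by
      intro x hx
      by_cases hxr : x ∈ ball (0 : EuclideanSpace ℝ (Fin 3)) r
      · exact Or.inl ⟨hxr, hx.2⟩
      · exact Or.inr ⟨hx.1, hxr⟩
    have h1 := (measure_mono (μ := volume) hsub).trans (measure_union_le _ _)
    have hf1 : volume (ball (0 : EuclideanSpace ℝ (Fin 3)) r ∩ {x | Φ t x < γ * κ}) ≠ ∞ :=
      ((measure_mono inter_subset_left).trans_lt measure_ball_lt_top).ne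
    have hf2 : volume (ball (0 : EuclideanSpace ℝ (Fin 3)) ρ \ ball (0 : EuclideanSpace ℝ (Fin 3)) r) ≠ ∞ :=
      ((measure_mono sdiff_subset).trans_lt hBfin).ne
    have h2 := ENNReal.toReal_mono (ENNReal.add_ne_top.2 ⟨hf1, hf2⟩) h1
    rwa [ENNReal.toReal_add hf1 hf2] at h2
  have hannle : ann ≤ 3 * σ * V := by
    have hrρ : r ≤ ρ := (hrr₁.trans hr₁ρ).le
    have hrvol : (volume (ball (0 : EuclideanSpace ℝ (Fin 3)) r)).toReal = V₁ * r ^ 3 := by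
      rw [Measure.addHaar_ball_of_pos volume _ hrpos, finrank_euclideanSpace_fin, ENNReal.toReal_mul,
        ENNReal.toReal_ofReal (by positivity), ← hV₁]; ring
    have h0 := measure_sdiff_add_inter (μ := volume) (ball (0 : EuclideanSpace ℝ (Fin 3)) ρ)
      (measurableSet_ball (x := (0 : EuclideanSpace ℝ (Fin 3))) (ε := r))
    rw [inter_eq_right.2 (ball_subset_ball hrρ)] at h0
    have hf1 : volume (ball (0 : EuclideanSpace ℝ (Fin 3)) ρ \ ball (0 : EuclideanSpace ℝ (Fin 3)) r) ≠ ∞ :=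
      ((measure_mono sdiff_subset).trans_lt hBfin).ne
    have h1 := congrArg ENNReal.toReal h0
    rw [ENNReal.toReal_add hf1 measure_ball_lt_top.ne, hBreal, hrvol, ← hann] at h1
    have hcube := one_sub_three_mul_le_cube hσpos.le (by linarith : σ ≤ 3)
    have hVρ : 0 ≤ V₁ * ρ ^ 3 := by positivity
    have hannval : ann = (1 - (1 - σ) ^ 3) * (V₁ * ρ ^ 3) := by rw [hr] at h1; linear_combination h1
    rw [hannval, hVdef]
    exact mul_le_mul_of_nonneg_right (by linarith) hVρ
  -- ### conclusion
  have hmV : m ≤ (1 - δ₀ / 3) * V :=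
    densityPropagation_arith_sq hγ.le hγ1 hV0 hΔ0.le hΔ hmain he hm₀le hmle hannle h3σ
  have hfinm : volume (ball (0 : EuclideanSpace ℝ (Fin 3)) ρ ∩ {x | Φ t x < γ * κ}) ≠ ∞ :=
    ((measure_mono inter_subset_left).trans_lt hBfin).ne
  rw [hsplit t (γ * κ)]
  -- `ofReal (δ₀/3) |B| ≤ |B| - |B ∩ {Φ t < γκ}|` from `m ≤ (1 - δ₀/3) V`
  have hballV : volume (ball (0 : EuclideanSpace ℝ (Fin 3)) ρ) = ENNReal.ofReal V := by
    rw [← hBreal, ENNReal.ofReal_toReal hBfin.ne]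
  have hSm : volume (ball (0 : EuclideanSpace ℝ (Fin 3)) ρ ∩ {x | Φ t x < γ * κ}) =
      ENNReal.ofReal m := (ENNReal.ofReal_toReal hfinm).symm
  have h1 : volume (ball (0 : EuclideanSpace ℝ (Fin 3)) ρ ∩ {x | Φ t x < γ * κ}) +
      ENNReal.ofReal (δ₀ / 3) * volume (ball (0 : EuclideanSpace ℝ (Fin 3)) ρ) ≤
      volume (ball (0 : EuclideanSpace ℝ (Fin 3)) ρ) := by
    have hδ3 : 0 ≤ δ₀ / 3 := by positivity
    have hm0 : 0 ≤ m := ENNReal.toReal_nonneg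
    have key : m + δ₀ / 3 * V ≤ V := by
      calc m + δ₀ / 3 * V ≤ (1 - δ₀ / 3) * V + δ₀ / 3 * V := add_le_add hmV le_rfl
        _ = V := by ring
    rw [hSm, hballV, ← ENNReal.ofReal_mul hδ3, ← ENNReal.ofReal_add hm0 (mul_nonneg hδ3 hV0)]
    exact ENNReal.ofReal_le_ofReal key
  exact ENNReal.le_sub_of_add_le_left hfinm h1

end Summit.NavierStokesRegularity.NavierStokesRegularity.Theorems.AveragedConeLiouville.NUPositivity

namespace Summit.NavierStokesRegularity.NavierStokesRegularity.Theorems.AveragedConeLiouville.NU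

open Summit.NavierStokesRegularity.NavierStokesRegularity.Theorems.AveragedConeLiouville.NUPositivity

/-- **L32ᴸ = `Sig.nuLip_densityPropagation` VERBATIM (kit `N4-T1-skeleton.lean` 118454bf17607d1e): N–U 2011
Lemma 3.2 over the standing hypotheses with LIPSCHITZ slices `NUStandingLip`** — an instance of the
slice-clause-free core `nu_densityPropagation_of_energyClass`.
[cite: NazarovUraltseva2011HarnackDivFree, Lemma 3.2 (arXiv:1011.1888 p. 9)] -/
theorem nuLip_densityPropagation : Sig.nuLip_densityPropagation := by
  intro δ₀ N hδ₀ hδ₀1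
  obtain ⟨θ₀, h0, h1, h⟩ := nu_densityPropagation_of_energyClass δ₀ N hδ₀ hδ₀1
  refine ⟨θ₀, h0, h1, fun Φ U k R hSt => ?_⟩
  obtain ⟨-, hR, hΦm, hUvol, -, hΦ0, -, hdrift, hEC⟩ := hSt
  exact h Φ U k R hR hΦm hUvol hΦ0 hdrift hEC

/-- Landing check: the theorem's type is literally the kit text. -/
example : Sig.nuLip_densityPropagation := nuLip_densityPropagation

end Summit.NavierStokesRegularity.NavierStokesRegularity.Theorems.AveragedConeLiouville.NU

end
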